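import Summits.ResolutionOfSingularities.ResolutionOfSingularities.Theorems.WildQuotientsSummitReductionStubPairQuasiSplitNormalFormLemmas4
import Summits.ResolutionOfSingularities.ResolutionOfSingularities.Theorems.WildQuotientsSummitReductionStubPairQuasiSplitNormalFormLemmas6
import Summits.ResolutionOfSingularities.ResolutionOfSingularities.Theorems.WildQuotientsSummitReductionStubPairQuasiSplitNormalFormLemmas9
import Summits.ResolutionOfSingularities.ResolutionOfSingularities.Theorems.WildQuotientsSummitReductionStubPairQuasiSplitNormalFormLemmas10
import Literature.AlgebraicGeometry.Resolution.QuasiSplitNormalFormPair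
import Literature.AlgebraicGeometry.Resolution.AlterationsIsNormalFormParts
import HarnessLib

/-!
# `WildQuotients.SummitReduction` (stmt-ResolutionOfSingularities-16324), line `FramePerfect`, skeleton v8:
# stub `stub_pair_quasiSplitNormalForm` (N) — de Jong 1996, 3.5 with 4.24 for QUASI-SPLIT `G`-semi-stable
# pairs with `codim(Sing X, X) ≥ 3` over a perfect field: the pair is a `DeJong1997.QuasiSplitNormalFormPair`

Route `ResolutionOfSingularities/WildQuotients`, crux `SummitReduction`; registered stub of the line skeleton
`Cruxes/SummitReduction/Lines/FramePerfect.lean` (v8, lead c4). Worker file.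

De Jong 1997, proof of Prop. 5.11 (p. 619): "Thus we may assume that `X → S` is quasi-split semi-stable and
`codim(Sing(X), X) ≥ 3`. The rest of our argument is similar to the arguments of [1, 4.24–4.28] and
[1, 7.16]. The types of complete local rings that we have now are `A⟦u, v⟧/(uv - t₁ ⋯ t_s)`, where `A` is a
regular complete local ring with a regular system of parameters `t₁, …, t_{d-1}`, and `D` is given by
`t₁ ⋯ t_r = 0`, for some `1 ≤ s ≤ r ≤ d - 1`. … Any `G`-orbit of a component of the singular locus of `X` is
nonsingular." The invariant of the ensuing orbit blow-up iteration is the Literature structure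
`DeJong1997.QuasiSplitNormalFormPair` (`QuasiSplitNormalFormPair.lean`); this file proves that the total space
of a quasi-split `G`-semi-stable pair with `codim(Sing X, X) ≥ 3` over a PERFECT field, with its boundary
`Z = ⋃ᵢ τᵢ(Y) ∪ f⁻¹(D)` and its action, satisfies it — de Jong 1996, 3.5 with 4.24 (the tree's
`DeJong1996SemiStablePairIsNormalForm_holds`, over an algebraically closed field and one component at a
time) made quasi-split, coefficient-free and equivariant. Field by field:

* `isClosed`, `isClosed_setOf_not_isRegularLocalRing` — the tree (`SemiStablePair.isClosed_semiStableBoundary`;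
  `isClosed_setOf_not_isRegularLocalRing` over the perfect `k`, Matsumura 30.5);
* `exists_isEffectiveCartier` — 4.24 [B1] over any field (`…Lemmas.lean`);
* `isSNCIdeal_completedStalkIdeal` — 4.24 [B2] / 4.25 (i) at the regular closed points of `Z`: smooth
  points (`…Lemmas5.lean`) and regular points of `Sing(f)` (`…Lemmas6.lean`, from the quasi-split nodal
  structure of `…Lemmas2/3.lean`);
* `exists_ringEquiv_of_not_isRegularLocalRing` — 3.5 / 4.25 (ii) coefficient-free (`…Lemmas4.lean`);
* `isRegular_subscheme_orbit` — de Jong 1997, 5.11 ¶2 via `G`-strictness (`…Lemmas7–10.lean` and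
  `isRegular_subscheme_orbit_of_quasiSplit` below: at a closed point `x₀ ∈ g₀(Ē)` the germ of the closed
  union `⋃_g g(Ē)` is `I_{g₀(E),x₀}` since translates through `x₀` have the same germ, and
  `𝒪_{X,x₀}/I_{g₀(E),x₀}` is regular; regularity generises, `X` being Jacobson).
-/

set_option linter.dupNamespace false

noncomputable section

open CategoryTheory CategoryTheory.Limits AlgebraicGeometry TopologicalSpace Topology
open Literature.AlgebraicGeometry.Resolution
open Literature.AlgebraicGeometry
open IsLocalRing Scheme.IdealSheafData DeJong1996

namespace Summit.ResolutionOfSingularities.ResolutionOfSingularities.Theorems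

/-! ## The orbit field -/

/-- **de Jong 1997, 5.11 ¶2: "Any `G`-orbit of a component of the singular locus of `X` is
nonsingular"** (field `isRegular_subscheme_orbit` of `DeJong1997.QuasiSplitNormalFormPair`), for
the quasi-split `G`-semi-stable pairs of the line with `codim(Sing X, X) ≥ 3` over an arbitrary
field (the singular locus being closed): for every irreducible component `E` of `Sing(X)`, the
reduced closed subscheme on the closure of `⋃_g g(Ē)` is a regular scheme. At a closed point
`x₀ ∈ g₀(Ē)` the germ of the (closed) union is `⋂_{g : x₀ ∈ g(Ē)} I_{g(E),x₀} = I_{g₀(E),x₀}`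
(`stalkIdeal_component_eq_of_translate`: translates through `x₀` have the same germ), and
`𝒪_{X,x₀}/I_{g₀(E),x₀}` is regular (`isRegularLocalRing_quotient_component_of_quasiSplit`); every
point of the union specialises to a closed point of it (`X` is Jacobson) and regularity of the
quotient stalks generises. [cite: DeJong1997, proof of Prop. 5.11, p. 619] [cite: DeJong1996, 3.5, p. 64] -/
theorem isRegular_subscheme_orbit_of_quasiSplit (k : Type) [Field k] (X Y : Scheme.{0}) [IsIntegral X]
    [IsIntegral Y] (f : X ⟶ Y) (q : Y ⟶ Spec (.of k)) (D : Set Y) (G : Type) [Group G] [Finite G]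
    (ρX : G →* Aut X) (ρY : G →* Aut Y) (hρf : ∀ g : G, (ρX g).hom ≫ f = f ≫ (ρY g).hom)
    (hDstrict : ∀ (g : G) (C : Set Y), Maximal (fun C : Set Y => IsIrreducible C ∧ C ⊆ D) C →
      (C ∩ (ρY g).hom.base '' C).Nonempty → (ρY g).hom.base '' C = C)
    (m : ℕ) (τ : Fin m → (Y ⟶ X)) (hS : DeJong1996.SemiStablePair f q D τ)
    (hqs : ∀ x : X, (¬ ∃ U : X.Opens, x ∈ U ∧ Smooth (U.ι ≫ f)) →
        ∃ e : AdicCompletion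
            ((IsLocalRing.maximalIdeal (X.presheaf.stalk x)).map (Ideal.Quotient.mk
              ((IsLocalRing.maximalIdeal (Y.presheaf.stalk (f.base x))).map (f.stalkMap x).hom)))
            (X.presheaf.stalk x ⧸
              (IsLocalRing.maximalIdeal (Y.presheaf.stalk (f.base x))).map (f.stalkMap x).hom) ≃+*
          MvPowerSeries (Fin 2) (Y.presheaf.stalk (f.base x) ⧸ IsLocalRing.maximalIdeal (Y.presheaf.stalk (f.base x))) ⧸
            Ideal.span {(MvPowerSeries.X 0 * MvPowerSeries.X 1 :
              MvPowerSeries (Fin 2) (Y.presheaf.stalk (f.base x) ⧸ IsLocalRing.maximalIdeal (Y.presheaf.stalk (f.base x))))},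
          e.toRingHom.comp ((algebraMap (X.presheaf.stalk x ⧸
              (IsLocalRing.maximalIdeal (Y.presheaf.stalk (f.base x))).map (f.stalkMap x).hom) _).comp
            (Ideal.quotientMap ((IsLocalRing.maximalIdeal (Y.presheaf.stalk (f.base x))).map (f.stalkMap x).hom)
              (f.stalkMap x).hom Ideal.le_comap_map)) =
          algebraMap (Y.presheaf.stalk (f.base x) ⧸ IsLocalRing.maximalIdeal (Y.presheaf.stalk (f.base x))) _)
    (hcodim : ∀ x : X, ¬ IsRegularLocalRing (X.presheaf.stalk x) →
      (3 : WithBot ℕ∞) ≤ ringKrullDim (X.presheaf.stalk x))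
    (hSc : IsClosed ({x : X | ¬ IsRegularLocalRing (X.presheaf.stalk x)} : Set X))
    (E : Set ↥({x : X | ¬ IsRegularLocalRing (X.presheaf.stalk x)} : Set X))
    (hE : E ∈ irreducibleComponents ↥({x : X | ¬ IsRegularLocalRing (X.presheaf.stalk x)} : Set X)) :
    Scheme.IsRegular
      (vanishingIdeal ⟨closure (⋃ g : G, (ρX g).hom.base '' (Subtype.val '' E)),
        isClosed_closure⟩).subscheme := by
  classical
  haveI := hS.isNoetherian
  haveI := hS.locallyOfFiniteType
  haveI : JacobsonSpace ↥X := LocallyOfFiniteType.jacobsonSpace (f ≫ q)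
  haveI : Fintype G := Fintype.ofFinite G
  -- the closed set `Z₀ = Ē = E` and its translates
  set Z₀ : Set X := Subtype.val '' E with hZ₀
  have hZ₀c : IsClosed Z₀ := by
    have h1 : IsClosed E := isClosed_of_mem_irreducibleComponents _ hE
    obtain ⟨C, hC, hCE⟩ := isClosed_induced_iff.mp h1
    have : Z₀ = ({x : X | ¬ IsRegularLocalRing (X.presheaf.stalk x)} : Set X) ∩ C := by
      rw [hZ₀, ← hCE, Subtype.image_preimage_coe]
    rw [this]
    exact hSc.inter hC
  have hgc : ∀ g : G, IsClosed ((ρX g).hom.base '' Z₀) := fun g =>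
    (Scheme.homeoOfIso (ρX g)).isClosedMap _ hZ₀c
  have hTc : IsClosed (⋃ g : G, (ρX g).hom.base '' Z₀) := isClosed_iUnion_of_finite hgc
  have hT : closure (⋃ g : G, (ρX g).hom.base '' Z₀) = ⋃ g : G, (ρX g).hom.base '' Z₀ := hTc.closure_eq
  set I := vanishingIdeal ⟨closure (⋃ g : G, (ρX g).hom.base '' Z₀), isClosed_closure⟩ with hI
  rw [Scheme.isRegular_subscheme_iff]
  intro x hx
  -- a closed point `x₀` of `cl{x}`, in the support
  obtain ⟨x₀, hx₀cl, -⟩ := nonempty_inter_closedPoints (Z := closure {x})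
    ⟨x, subset_closure rfl⟩ isClosed_closure.isLocallyClosed
  have hxx₀ : x ⤳ x₀ := specializes_iff_mem_closure.mpr hx₀cl
  have hx₀supp : x₀ ∈ I.support := hxx₀.mem_closed I.support.isClosed hx
  refine isRegularLocalRing_quotient_stalkIdeal_of_specializes _ hxx₀ hx ?_
  -- `x₀ ∈ g₀(Z₀)`
  have hx₀T : x₀ ∈ ⋃ g : G, (ρX g).hom.base '' Z₀ := by
    have h1 : x₀ ∈ ((I.support : Closeds X) : Set X) := hx₀supp
    rw [hI, coe_support_vanishingIdeal] at h1
    change x₀ ∈ closure (⋃ g : G, (ρX g).hom.base '' Z₀) at h1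
    rwa [hT] at h1
  obtain ⟨g₀, hg₀⟩ := Set.mem_iUnion.mp hx₀T
  -- the component `E₁ = g₀(E)` through `x₀`
  obtain ⟨E₁, hE₁, hE₁eq⟩ := exists_component_image_eq (ρX g₀) hE
  have hx₀E₁ : x₀ ∈ closure (Subtype.val '' E₁) := by
    rw [hE₁eq]
    exact subset_closure hg₀
  -- translates of `E` as translates of `E₁`
  have htrans : ∀ g : G, (ρX g).hom.base '' Z₀ = (ρX (g * g₀⁻¹)).hom.base '' (Subtype.val '' E₁) := by
    intro g
    have hfun : ∀ z : X, (ρX g).hom.base z = (ρX (g * g₀⁻¹)).hom.base ((ρX g₀).hom.base z) := by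
      intro z
      have h := Scheme.Hom.comp_apply (ρX g₀).hom (ρX (g * g₀⁻¹)).hom z
      rw [← Iso.trans_hom, ← CategoryTheory.Aut.Aut_mul_def, ← map_mul, inv_mul_cancel_right] at h
      exact h
    calc (ρX g).hom.base '' Z₀
        = (fun z => (ρX (g * g₀⁻¹)).hom.base ((ρX g₀).hom.base z)) '' Z₀ := Set.image_congr' hfun
      _ = (ρX (g * g₀⁻¹)).hom.base '' ((ρX g₀).hom.base '' Z₀) := (Set.image_image _ _ _).symm
      _ = _ := by rw [hE₁eq]
  -- the germ of the union at `x₀` is the germ of `E₁`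
  have key : stalkIdeal I x₀ = stalkIdeal (singularComponentIdeal E₁) x₀ := by
    have hsup : (⟨closure (⋃ g : G, (ρX g).hom.base '' Z₀), isClosed_closure⟩ : Closeds X) =
        Finset.univ.sup fun g : G => (⟨(ρX g).hom.base '' Z₀, hgc g⟩ : Closeds X) := by
      ext1
      rw [Closeds.coe_finset_sup, Finset.sup_set_eq_biUnion]
      change closure (⋃ g : G, (ρX g).hom.base '' Z₀) = _
      rw [hT]
      ext z
      simp
    rw [hI, hsup, Finset.sup_univ_eq_iSup, vanishingIdeal_iSup, ← Finset.inf_univ_eq_iInf,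
      stalkIdeal_finset_inf]
    -- each term is `I_{E₁,x₀}` or `⊤`
    have hterm : ∀ g : G, x₀ ∈ (ρX g).hom.base '' Z₀ →
        stalkIdeal (vanishingIdeal (⟨(ρX g).hom.base '' Z₀, hgc g⟩ : Closeds X)) x₀ =
          stalkIdeal (singularComponentIdeal E₁) x₀ := by
      intro g hg
      obtain ⟨Eg, hEg, hEgeq⟩ := exists_component_image_eq (ρX (g * g₀⁻¹)) hE₁
      rw [← htrans g] at hEgeq
      have hcl : (⟨(ρX g).hom.base '' Z₀, hgc g⟩ : Closeds X) =
          ⟨closure (Subtype.val '' Eg), isClosed_closure⟩ := by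
        apply Closeds.ext
        change (ρX g).hom.base '' Z₀ = closure (Subtype.val '' Eg)
        rw [hEgeq, (hgc g).closure_eq]
      rw [hcl]
      have hx₀Eg : x₀ ∈ closure (Subtype.val '' Eg) := by
        rw [hEgeq]
        exact subset_closure hg
      exact (stalkIdeal_component_eq_of_translate k X Y f q D G ρX ρY hρf hDstrict m τ hS hqs hcodim
        hSc hE₁ hEg (g * g₀⁻¹) (hEgeq.trans (htrans g)) hx₀E₁ hx₀Eg).symm
    have hterm' : ∀ g : G, x₀ ∉ (ρX g).hom.base '' Z₀ →
        stalkIdeal (vanishingIdeal (⟨(ρX g).hom.base '' Z₀, hgc g⟩ : Closeds X)) x₀ = ⊤ := by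
      intro g hg
      apply stalkIdeal_eq_top_of_not_mem_support
      rw [← SetLike.mem_coe, coe_support_vanishingIdeal]
      exact hg
    apply le_antisymm
    · refine (Finset.inf_le (Finset.mem_univ g₀)).trans ?_
      rw [hterm g₀ hg₀]
    · refine Finset.le_inf fun g _ => ?_
      by_cases hg : x₀ ∈ (ρX g).hom.base '' Z₀
      · rw [hterm g hg]
      · rw [hterm' g hg]
        exact le_top
  rw [key]
  -- regularity of `𝒪_{X,x₀}/I_{E₁,x₀}` at the closed singular point `x₀`
  have hsub : closure (Subtype.val '' E₁) ⊆
      ({x : X | ¬ IsRegularLocalRing (X.presheaf.stalk x)} : Set X) :=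
    closure_minimal (by rintro _ ⟨z, -, rfl⟩; exact z.2) hSc
  have hreg : ¬ IsRegularLocalRing (X.presheaf.stalk x₀) := hsub hx₀E₁
  obtain ⟨e₁, he₁⟩ := hqs x₀ (fun ⟨U, hU, hsm⟩ => hS.not_smooth_of_not_isRegularLocalRing hreg U hU hsm)
  exact isRegularLocalRing_quotient_component_of_quasiSplit hS hcodim hSc hE₁ hx₀E₁ e₁ he₁

/-! ## The stub -/

/-- **De Jong 1996, 3.5 with 4.24 for QUASI-SPLIT `G`-semi-stable pairs with `codim(Sing X, X) ≥ 3`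
over a perfect field** (de Jong 1997, 5.11 ¶2: "The types of complete local rings that we have now are
`A⟦u,v⟧/(uv - t₁ ⋯ t_s)` … Any `G`-orbit of a component of the singular locus of `X` is nonsingular"):
the pair `(X, ⋃ᵢ τᵢ(Y) ∪ f⁻¹ D)` with the action `ρX` is a `DeJong1997.QuasiSplitNormalFormPair` of
dimension `d = dim X`. Assembly of the fields from the helper files `…StubPairQuasiSplitNormalFormLemmas*.lean`:
the boundary is an effective Cartier divisor ([B1], any field); at a regular closed point of `Z` the
completed ideal of `Z` is an SNC ideal (smooth points: a regular system of parameters of `𝒪_{X,x}` adapted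
to the sections and `f⁻¹D`; regular points of `Sing(f)`: `𝒪̂_{X,x} ≅ κ⟦u, v, T⟧/(uv - T_{i₀})` from the
quasi-split datum, `Î_Z = (u v ∏_{i<ρ, i≠i₀} Tᵢ)`); at a singular closed point
`𝒪̂_{X,x} ≅ A⟦u, v⟧/(uv - ∏_{i<s} tᵢ)`, `A = κ⟦T₁, …, T_{d-1}⟧`, `2 ≤ s ≤ r ≤ d - 1`, `Î_Z = (∏_{i<r} tᵢ)`
(3.3 at a quasi-split point, `nᵢ ∈ {0, 1}` from `codim ≥ 3`); the singular locus is closed (`k` perfect);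
and the `G`-orbit of a singular component is a regular subscheme (translates through a common point have
the same germ by `G`-strictness of `D`, and each component is regular by 3.5 [B5]).
[cite: DeJong1996, 3.5 and 4.24–4.25, pp. 64–65, 75] [cite: DeJong1997, proof of Prop. 5.11, p. 619] -/
theorem stub_pair_quasiSplitNormalForm (k : Type) [Field k] [PerfectField k] (X Y : Scheme.{0}) [IsIntegral X] [IsIntegral Y]
    (f : X ⟶ Y) (q : Y ⟶ Spec (.of k))
    (hprojX : Motives.IsProjectiveOver (Over.mk (f ≫ q))) (hprojY : Motives.IsProjectiveOver (Over.mk q)) (hreg : Scheme.IsRegular Y)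
    (D : Set Y) (hD : IsStrictNormalCrossingsDivisor Y D)
    (G : Type) [Group G] [Finite G] (ρX : G →* Aut X) (ρY : G →* Aut Y)
    (hρf : (∀ g : G, (ρX g).hom ≫ f = f ≫ (ρY g).hom))
    (_hDG : (∀ g : G, (ρY g).hom.base '' D = D))
    (hDstrict : (∀ (g : G) (C : Set Y), Maximal (fun C : Set Y => IsIrreducible C ∧ C ⊆ D) C →
        (C ∩ (ρY g).hom.base '' C).Nonempty → (ρY g).hom.base '' C = C))
    (hss : IsSemiStableCurve f)
    (hqs : (∀ x : X, (¬ ∃ U : X.Opens, x ∈ U ∧ Smooth (U.ι ≫ f)) →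
        ∃ e : AdicCompletion
            ((IsLocalRing.maximalIdeal (X.presheaf.stalk x)).map (Ideal.Quotient.mk
              ((IsLocalRing.maximalIdeal (Y.presheaf.stalk (f.base x))).map (f.stalkMap x).hom)))
            (X.presheaf.stalk x ⧸
              (IsLocalRing.maximalIdeal (Y.presheaf.stalk (f.base x))).map (f.stalkMap x).hom) ≃+*
          MvPowerSeries (Fin 2) (Y.presheaf.stalk (f.base x) ⧸ IsLocalRing.maximalIdeal (Y.presheaf.stalk (f.base x))) ⧸
            Ideal.span {(MvPowerSeries.X 0 * MvPowerSeries.X 1 :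
              MvPowerSeries (Fin 2) (Y.presheaf.stalk (f.base x) ⧸ IsLocalRing.maximalIdeal (Y.presheaf.stalk (f.base x))))},
          e.toRingHom.comp ((algebraMap (X.presheaf.stalk x ⧸
              (IsLocalRing.maximalIdeal (Y.presheaf.stalk (f.base x))).map (f.stalkMap x).hom) _).comp
            (Ideal.quotientMap ((IsLocalRing.maximalIdeal (Y.presheaf.stalk (f.base x))).map (f.stalkMap x).hom)
              (f.stalkMap x).hom Ideal.le_comap_map)) =
          algebraMap (Y.presheaf.stalk (f.base x) ⧸ IsLocalRing.maximalIdeal (Y.presheaf.stalk (f.base x))) _))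
    (hsm : Smooth (f ∣_ ⟨Dᶜ, hD.isClosed.isOpen_compl⟩))
    (m : ℕ) (τ : Fin m → (Y ⟶ X)) (hτf : (∀ i : Fin m, τ i ≫ f = 𝟙 Y))
    (hτdisj : (Pairwise fun i j : Fin m => Disjoint (Set.range (τ i)) (Set.range (τ j))))
    (hτsm : (∀ i : Fin m, ∃ U : X.Opens, Set.range (τ i) ⊆ (U : Set X) ∧ Smooth (U.ι ≫ f)))
    (_hτG : (∀ (g : G) (i : Fin m), ∃ j : Fin m, τ i ≫ (ρX g).hom = (ρY g).hom ≫ τ j))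
    (hcodim : (∀ x : X, ¬ IsRegularLocalRing (X.presheaf.stalk x) →
            (3 : WithBot ℕ∞) ≤ ringKrullDim (X.presheaf.stalk x))) :
    ∃ d : ℕ, DeJong1997.QuasiSplitNormalFormPair (f ≫ q) (DeJong1996.semiStableBoundary f D τ) ρX d := by
  classical
  -- the pair in Situation 4.23 (over the perfect field `k`)
  have hS : DeJong1996.SemiStablePair f q D τ :=
    { isIntegral := inferInstance
      isProjectiveOver := hprojX
      isIntegral_base := inferInstance
      isProjectiveOver_base := hprojY
      isRegular_base := hreg
      isStrictNormalCrossingsDivisor := hD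
      isSemiStableCurve := hss
      smooth_morphismRestrict := hsm
      comp_eq_id := hτf
      pairwise_disjoint := hτdisj
      exists_smooth := hτsm }
  haveI := hS.isNoetherian
  haveI := hS.locallyOfFiniteType
  haveI : CompactSpace X :=
    (HasAffineProperty.iff_of_isAffine (P := @QuasiCompact)).mp hS.quasiCompact
  -- `d = dim X`
  obtain ⟨d₀, hd₀⟩ := exists_topologicalKrullDim_le_of_locallyOfFiniteType (f ≫ q)
  obtain ⟨d, hd⟩ := exists_topologicalKrullDim_eq_nat hd₀
  -- the singular locus is closed (`k` perfect)
  have hSc := hS.isClosed_setOf_not_isRegularLocalRing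
  refine ⟨d,
    { isIntegral := inferInstance
      isProjectiveOver := hprojX
      topologicalKrullDim_eq := hd
      isClosed := hS.isClosed_semiStableBoundary
      exists_isEffectiveCartier := exists_isEffectiveCartier_semiStableBoundary' hS
      isSNCIdeal_completedStalkIdeal := ?_
      exists_ringEquiv_of_not_isRegularLocalRing := ?_
      isClosed_setOf_not_isRegularLocalRing := hSc
      isRegular_subscheme_orbit := ?_ }⟩
  · -- 4.25 (i) at the regular closed points of `Z`
    intro x hx hregx hxZ U hU
    by_cases hsmx : ∃ V : X.Opens, x ∈ V ∧ Smooth (V.ι ≫ f)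
    · obtain ⟨V, hxV, hV⟩ := hsmx
      exact isSNCIdeal_completedStalkIdeal_boundary_of_smooth hS hV hxV hx hxZ U hU
    · have hns : ∀ V : X.Opens, x ∈ V → ¬ Smooth (V.ι ≫ f) := fun V hxV hV => hsmx ⟨V, hxV, hV⟩
      obtain ⟨e₁, he₁⟩ := hqs x hsmx
      exact isSNCIdeal_completedStalkIdeal_boundary_of_not_smooth hS hregx hxZ hns e₁ he₁ U hU
  · -- 4.25 (ii) at the singular closed points
    intro x hx hregx
    have hns := hS.not_smooth_of_not_isRegularLocalRing hregx
    obtain ⟨e₁, he₁⟩ := hqs x (fun ⟨V, hxV, hV⟩ => hns V hxV hV)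
    exact exists_nodeDeformationRing_of_quasiSplit hS hcodim hd hx hregx e₁ he₁
  · -- the orbits of the singular components are regular
    intro E hE
    exact isRegular_subscheme_orbit_of_quasiSplit k X Y f q D G ρX ρY hρf hDstrict m τ hS hqs hcodim
      hSc E hE

end Summit.ResolutionOfSingularities.ResolutionOfSingularities.Theorems

end
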